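import Summits.FinalStateConjecture.FinalStateConjecture.Theorems.StarvedNecksSeamedChartsExhaustRide
import Summits.FinalStateConjecture.FinalStateConjecture.Theorems.StarvedNecksNecksCertifyStubSeamFlatRestrict

/-!
# Route StarvedNecks — crux `NecksCertify`, line `two-cap-focusing-ledger`: seam surgery, co-moving rides

Helper file for the registered stub `stub_seamSurgery` (N2): the causal bookkeeping along the
co-moving lines `u ↦ x + u Λe₀` of one hole through the re-gauged chart `Ψ'` of the atlas
(`C^∞` on the tube `U = {τ₁ < t, r < Rg(t) + 2}`, pushed time-lines future-directed on the
certified tube, clause A8), all charts and clauses entering as hypotheses: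

* `stub_seamSurgery_ride` (registered helper sub-goal) = `ride_mem_causalFuture` — the ride is a
  future causal curve (`line_mem_causalFuture` applied to `Ψ'` restricted to the open `U ⊆ E4`);
* `drain_cover` — the early collar of the hole drains into the re-clocked hole slab `{t = T + s}` or
  the flat slab `{y⁰ = T}` of the seamed decomposition (its covering clause);
* `upward` — every tube/collar point is causally below the late charted region of the seamed
  decomposition (for `O = exteriorOf 𝒟 d₂.charted`).

References: B. O'Neill, *Semi-Riemannian geometry*, Academic Press 1983, Ch. 14, p. 402.
Mathlib + the landed `…SeamedChartsExhaustRide` and `…StubSeamFlatRestrict` modules; no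
definitions, no named facts.
-/

noncomputable section

open scoped Manifold ContDiff Topology ENNReal
open Filter Set Function Topology Literature.Geometry.Lorentzian

namespace Summit.FinalStateConjecture.FinalStateConjecture.Theorems.NecksCertifyTwoCap.Seam

set_option linter.dupNamespace false

open Summit.FinalStateConjecture.FinalStateConjecture.Theorems.SeamedChartsExhaust.WideAnchoring
  (radius_add_smul_e₀ poincareInv_add_smul)
open Summit.FinalStateConjecture.FinalStateConjecture.Theorems.SeamedChartsExhaust.Negative
  (line_mem_causalFuture)


/-- **The co-moving ride through the re-gauged chart is causal.**  On the boosted Kerr background of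
a motion `(Λ, c)`, if the re-gauged chart `Ψ'` is `C^∞` on `U = {τ₁ < t, r < Rg(t) + 2}` (`Rg`
monotone and continuous) and its pushed time-lines `dΨ'(Λe₀)` are future-directed on
`{τ₁ ≤ t, R₁ ≤ r ≤ Rg(t) + 2}` (clause A8), then for every `x ∈ U` with `R₁ ≤ r(x)` and `u ≥ 0`
the point `Ψ'(x + u Λe₀)` (same radius, hole time `+u`) lies in `J⁺(Ψ' x)`: the ride is the image
of a coordinate line through the chart `Ψ'` restricted to the open set `U ⊆ E4`
(`line_mem_causalFuture`).  O'Neill 1983, Ch. 14, p. 402. [folklore] -/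
theorem ride_mem_causalFuture {𝓢 : Spacetime.{0} 4} (Λ : lorentzGroup) (c : E4) (M a R₁ τ₁ : ℝ) (Rg : ℝ → ℝ)
    (hRgm : Monotone Rg) (hRgc : Continuous Rg)
    (Ψ' : (boostedKerrBackground Λ c M a).domain → 𝓢.carrier)
    (hA1a : ContMDiffOn 𝓘(ℝ, E4) (𝓡 4) ∞ Ψ'
      {x | τ₁ < (boostedKerrBackground Λ c M a).time x ∧ (boostedKerrBackground Λ c M a).radius x <
        Rg ((boostedKerrBackground Λ c M a).time x) + 2})
    (hA8 : ∀ x : (boostedKerrBackground Λ c M a).domain, τ₁ ≤ (boostedKerrBackground Λ c M a).time x →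
      R₁ ≤ (boostedKerrBackground Λ c M a).radius x →
      (boostedKerrBackground Λ c M a).radius x ≤ Rg ((boostedKerrBackground Λ c M a).time x) + 2 →
      𝓢.timeOrientation.IsFutureDirected
        (mfderiv 𝓘(ℝ, E4) (𝓡 4) Ψ' x ((Λ : E4 ≃L[ℝ] E4) (E4.basisVector 0))))
    (hdomeq : ∀ y y' : E4, (boostedKerrBackground Λ c M a).radius y' =
      (boostedKerrBackground Λ c M a).radius y → y ∈ (boostedKerrBackground Λ c M a).domain →
      y' ∈ (boostedKerrBackground Λ c M a).domain)
    (x : E4) (hx : x ∈ (boostedKerrBackground Λ c M a).domain)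
    (ht : τ₁ < (boostedKerrBackground Λ c M a).time x) (hr1 : R₁ ≤ (boostedKerrBackground Λ c M a).radius x)
    (hr2 : (boostedKerrBackground Λ c M a).radius x < Rg ((boostedKerrBackground Λ c M a).time x) + 2)
    (u : ℝ) (hu : 0 ≤ u) (hxu : x + u • (Λ : E4 ≃L[ℝ] E4) (E4.basisVector 0) ∈
      (boostedKerrBackground Λ c M a).domain) :
    Ψ' ⟨x + u • (Λ : E4 ≃L[ℝ] E4) (E4.basisVector 0), hxu⟩ ∈
      𝓢.metric.causalFuture 𝓢.timeOrientation {Ψ' ⟨x, hx⟩} := by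
  have htv : ∀ (y : E4) (σ : ℝ), (boostedKerrBackground Λ c M a).time (y + σ • (Λ : E4 ≃L[ℝ] E4) (E4.basisVector 0)) =
      (boostedKerrBackground Λ c M a).time y + σ := fun y σ ↦ by
    show poincareInv Λ c (y + σ • (Λ : E4 ≃L[ℝ] E4) (E4.basisVector 0)) 0 = poincareInv Λ c y 0 + σ
    rw [poincareInv_add_smul]; simp
  have hrv : ∀ (y : E4) (σ : ℝ), (boostedKerrBackground Λ c M a).radius (y + σ • (Λ : E4 ≃L[ℝ] E4) (E4.basisVector 0)) =
      (boostedKerrBackground Λ c M a).radius y := fun y σ ↦ by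
    show Kerr.radius a (poincareInv Λ c (y + σ • (Λ : E4 ≃L[ℝ] E4) (E4.basisVector 0))) =
      Kerr.radius a (poincareInv Λ c y)
    rw [poincareInv_add_smul, radius_add_smul_e₀]
  have hTc : Continuous (boostedKerrBackground Λ c M a).time :=
    (PiLp.continuous_apply 2 _ 0).comp (continuous_poincareInv Λ c)
  have hRc : Continuous (boostedKerrBackground Λ c M a).radius :=
    (Kerr.continuous_radius a).comp (continuous_poincareInv Λ c)
  -- the open subset `U ⊆ E4` and the chart on it
  set S : Set E4 := ((boostedKerrBackground Λ c M a).domain : Set E4) ∩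
      {y | τ₁ < (boostedKerrBackground Λ c M a).time y ∧
        (boostedKerrBackground Λ c M a).radius y < Rg ((boostedKerrBackground Λ c M a).time y) + 2} with hS
  have hSo : IsOpen S := (boostedKerrBackground Λ c M a).domain.isOpen.inter
    ((isOpen_lt continuous_const hTc).inter (isOpen_lt hRc ((hRgc.comp hTc).add continuous_const)))
  let UE : TopologicalSpace.Opens E4 := ⟨S, hSo⟩
  have hmemUE : ∀ y : E4, y ∈ UE ↔ y ∈ S := fun y ↦ Iff.rfl
  have hUEdom : UE ≤ (boostedKerrBackground Λ c M a).domain := fun y hy ↦ ((hmemUE y).mp hy).1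
  have hUo : IsOpen {x : (boostedKerrBackground Λ c M a).domain | τ₁ < (boostedKerrBackground Λ c M a).time x ∧
      (boostedKerrBackground Λ c M a).radius x < Rg ((boostedKerrBackground Λ c M a).time x) + 2} :=
    (isOpen_lt continuous_const (hTc.comp continuous_subtype_val)).inter
      (isOpen_lt (hRc.comp continuous_subtype_val)
        (((hRgc.comp hTc).add continuous_const).comp continuous_subtype_val))
  have hmapsU : ∀ y : UE, TopologicalSpace.Opens.inclusion hUEdom y ∈
      {x : (boostedKerrBackground Λ c M a).domain | τ₁ < (boostedKerrBackground Λ c M a).time x ∧ (boostedKerrBackground Λ c M a).radius x < Rg ((boostedKerrBackground Λ c M a).time x) + 2} := fun y ↦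
    ((hmemUE y.1).mp y.2).2
  let Ψ'' : UE → 𝓢.carrier := Ψ' ∘ TopologicalSpace.Opens.inclusion hUEdom
  have hΨ''s : ContMDiff 𝓘(ℝ, E4) (𝓡 4) ∞ Ψ'' :=
    hA1a.comp_contMDiff (contMDiff_inclusion hUEdom) hmapsU
  have hmf : ∀ z : UE, mfderiv 𝓘(ℝ, E4) (𝓡 4) Ψ'' z =
      mfderiv 𝓘(ℝ, E4) (𝓡 4) Ψ' (TopologicalSpace.Opens.inclusion hUEdom z) := fun z ↦
    NecksCertifyBargmann.FlatRestrict.mfderiv_comp_inclusion_eq hUEdom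
      ((hA1a.contMDiffAt (hUo.mem_nhds (hmapsU z))).mdifferentiableAt (by simp))
  -- room below `t x`
  obtain ⟨δ, hδ, hδ'⟩ : ∃ δ > 0, ∀ t', |t' - (boostedKerrBackground Λ c M a).time x| < δ → (boostedKerrBackground Λ c M a).radius x < Rg t' + 2 := by
    have hgap : 0 < Rg ((boostedKerrBackground Λ c M a).time x) + 2 - (boostedKerrBackground Λ c M a).radius x := by linarith
    obtain ⟨δ, hδ, h⟩ := Metric.continuousAt_iff.mp hRgc.continuousAt _ hgap
    refine ⟨δ, hδ, fun t' ht' ↦ ?_⟩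
    have := h ht'
    rw [Real.dist_eq, abs_lt] at this
    linarith [this.1]
  set ε : ℝ := min (δ / 2) (((boostedKerrBackground Λ c M a).time x - τ₁) / 2) with hε
  have hε0 : 0 < ε := lt_min (by linarith) (by linarith)
  have hεδ : ε < δ := (min_le_left _ _).trans_lt (by linarith)
  have hεt : ε < (boostedKerrBackground Λ c M a).time x - τ₁ := (min_le_right _ _).trans_lt (by linarith)
  have hxUE : x ∈ UE := (hmemUE x).mpr ⟨hx, ht, hr2⟩
  have hseg : ∀ σ : ℝ, -ε ≤ σ → x + σ • (Λ : E4 ≃L[ℝ] E4) (E4.basisVector 0) ∈ UE := by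
    intro σ hσ
    refine (hmemUE _).mpr ⟨hdomeq x _ (hrv x σ) hx, ?_, ?_⟩
    · show τ₁ < (boostedKerrBackground Λ c M a).time (x + σ • (Λ : E4 ≃L[ℝ] E4) (E4.basisVector 0)); rw [htv]; linarith
    · show (boostedKerrBackground Λ c M a).radius (x + σ • (Λ : E4 ≃L[ℝ] E4) (E4.basisVector 0)) <
        Rg ((boostedKerrBackground Λ c M a).time (x + σ • (Λ : E4 ≃L[ℝ] E4) (E4.basisVector 0))) + 2
      rw [hrv, htv]
      rcases le_or_gt 0 σ with h | h
      · linarith [hRgm (show (boostedKerrBackground Λ c M a).time x ≤ (boostedKerrBackground Λ c M a).time x + σ by linarith)]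
      · exact hδ' _ (by rw [abs_lt]; constructor <;> linarith)
  have key := line_mem_causalFuture hΨ''s ((Λ : E4 ≃L[ℝ] E4) (E4.basisVector 0)) x hxUE hu hε0 (fun σ hσ ↦ hseg σ hσ.1) ?_
  · exact key
  · rintro z ⟨σ, hσ, hzσ⟩
    rw [hmf]
    have hz : (z : E4) = x + σ • (Λ : E4 ≃L[ℝ] E4) (E4.basisVector 0) := hzσ.symm
    refine hA8 _ ?_ ?_ ?_
    · show τ₁ ≤ (boostedKerrBackground Λ c M a).time (z : E4); rw [hz, htv]; linarith [hσ.1]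
    · show R₁ ≤ (boostedKerrBackground Λ c M a).radius (z : E4); rw [hz, hrv]; exact hr1
    · show (boostedKerrBackground Λ c M a).radius (z : E4) ≤ Rg ((boostedKerrBackground Λ c M a).time (z : E4)) + 2
      rw [hz, hrv, htv]
      linarith [hRgm (show (boostedKerrBackground Λ c M a).time x ≤ (boostedKerrBackground Λ c M a).time x + σ by linarith [hσ.1])]


/-- Registered helper sub-goal `stub_seamSurgery_ride` of N2 (closed form of `ride_mem_causalFuture`). [folklore] -/
theorem stub_seamSurgery_ride :
    ∀ (𝓢 : Spacetime.{0} 4) (Λ : lorentzGroup) (c : E4) (M a R₁ τ₁ : ℝ) (Rg : ℝ → ℝ)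
    (hRgm : Monotone Rg) (hRgc : Continuous Rg)
    (Ψ' : (boostedKerrBackground Λ c M a).domain → 𝓢.carrier)
    (hA1a : ContMDiffOn 𝓘(ℝ, E4) (𝓡 4) ∞ Ψ'
      {x | τ₁ < (boostedKerrBackground Λ c M a).time x ∧ (boostedKerrBackground Λ c M a).radius x <
        Rg ((boostedKerrBackground Λ c M a).time x) + 2})
    (hA8 : ∀ x : (boostedKerrBackground Λ c M a).domain, τ₁ ≤ (boostedKerrBackground Λ c M a).time x →
      R₁ ≤ (boostedKerrBackground Λ c M a).radius x →
      (boostedKerrBackground Λ c M a).radius x ≤ Rg ((boostedKerrBackground Λ c M a).time x) + 2 →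
      𝓢.timeOrientation.IsFutureDirected
        (mfderiv 𝓘(ℝ, E4) (𝓡 4) Ψ' x ((Λ : E4 ≃L[ℝ] E4) (E4.basisVector 0))))
    (hdomeq : ∀ y y' : E4, (boostedKerrBackground Λ c M a).radius y' =
      (boostedKerrBackground Λ c M a).radius y → y ∈ (boostedKerrBackground Λ c M a).domain →
      y' ∈ (boostedKerrBackground Λ c M a).domain)
    (x : E4) (hx : x ∈ (boostedKerrBackground Λ c M a).domain)
    (ht : τ₁ < (boostedKerrBackground Λ c M a).time x) (hr1 : R₁ ≤ (boostedKerrBackground Λ c M a).radius x)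
    (hr2 : (boostedKerrBackground Λ c M a).radius x < Rg ((boostedKerrBackground Λ c M a).time x) + 2)
    (u : ℝ) (hu : 0 ≤ u) (hxu : x + u • (Λ : E4 ≃L[ℝ] E4) (E4.basisVector 0) ∈
      (boostedKerrBackground Λ c M a).domain),
        Ψ' ⟨x + u • (Λ : E4 ≃L[ℝ] E4) (E4.basisVector 0), hxu⟩ ∈
      𝓢.metric.causalFuture 𝓢.timeOrientation {Ψ' ⟨x, hx⟩} :=
  fun _ ↦ ride_mem_causalFuture

/-- **Draining the early collar of one hole to the slabs of the seamed decomposition** (covering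
clause for the seamed decomposition).  For a point `x` of the re-gauged chart with hole time in
`[τ₁ + 2 + s, T + s)` and `r < Rg + 2`: either `Ψ' x` lies in `J⁻` of (the `Gl`-image of the
re-clocked hole slab `{t = T + s}` ∪ the flat slab `{y⁰ = T}` outside the tubes), or `Ψ' x` is
itself a flat-late point outside the tubes.  Inside `R₁ + 1/4`: input anchoring; on the certified
tube: ride to hole time `T + s`; on and beyond the shell `Ψ' x` is a flat point (ONE ATLAS) and,
if flat-early, the ride to flat time `T` ends outside the tubes (flat slab) or deep inside the own
tube (then ride on to hole time `T + s`).  O'Neill 1983, Ch. 14, p. 402. [folklore] -/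
theorem drain_cover {𝓢 : Spacetime.{0} 4} (Λ : lorentzGroup) (c : E4) (M a R₁ τ₁ s τf T : ℝ)
    (hs : 0 ≤ s) (hτ : τf ≤ τ₁) (hT : τ₁ + 3 ≤ T)
    (hdomeq : ∀ y y' : E4, (boostedKerrBackground Λ c M a).radius y' = (boostedKerrBackground Λ c M a).radius y → y ∈ (boostedKerrBackground Λ c M a).domain → y' ∈ (boostedKerrBackground Λ c M a).domain)
    (Rg : ℝ → ℝ) (hRgm : Monotone Rg) (hRgc : Continuous Rg) (hRg4 : ∀ t, R₁ + 4 ≤ Rg t)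
    (b : ℝ → ℝ) (hbm : Monotone b) (hbRg : ∀ t, Rg t + 21 / 20 ≤ b t ∧ b t ≤ Rg t + 29 / 20)
    (Ψ Ψ' Gl : (boostedKerrBackground Λ c M a).domain → 𝓢.carrier)
    (hA1a : ContMDiffOn 𝓘(ℝ, E4) (𝓡 4) ∞ Ψ'
      {x | τ₁ < (boostedKerrBackground Λ c M a).time x ∧ (boostedKerrBackground Λ c M a).radius x < Rg ((boostedKerrBackground Λ c M a).time x) + 2})
    (hA2 : ∀ x : (boostedKerrBackground Λ c M a).domain, (boostedKerrBackground Λ c M a).radius x ≤ R₁ + 1 → Ψ' x = Ψ x)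
    (hA8 : ∀ x : (boostedKerrBackground Λ c M a).domain, τ₁ ≤ (boostedKerrBackground Λ c M a).time x → R₁ ≤ (boostedKerrBackground Λ c M a).radius x →
      (boostedKerrBackground Λ c M a).radius x ≤ Rg ((boostedKerrBackground Λ c M a).time x) + 2 →
      𝓢.timeOrientation.IsFutureDirected (mfderiv 𝓘(ℝ, E4) (𝓡 4) Ψ' x ((Λ : E4 ≃L[ℝ] E4) (E4.basisVector 0))))
    (hHc2 : ∀ ϱ τ₂ : ℝ, R₁ ≤ ϱ → τf < τ₂ →
      Ψ '' {x | τf < (boostedKerrBackground Λ c M a).time x ∧ (boostedKerrBackground Λ c M a).time x < τ₂ ∧ (boostedKerrBackground Λ c M a).radius x < ϱ} ⊆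
        𝓢.metric.causalPast 𝓢.timeOrientation (Ψ '' (boostedKerrBackground Λ c M a).truncTimeSlab ϱ τ₂))
    (W₀ : TopologicalSpace.Opens E4) (Φ : W₀ → 𝓢.carrier) (P : E4 → Prop)
    (hA3 : ∀ (y : E4) (hy : y ∈ (boostedKerrBackground Λ c M a).domain), τ₁ ≤ y 0 → P y →
      (boostedKerrBackground Λ c M a).radius y ≤ Rg ((boostedKerrBackground Λ c M a).time y) + 2 → ∃ hw : y ∈ W₀, Ψ' ⟨y, hy⟩ = Φ ⟨y, hw⟩)
    (hcollar : ∀ y : E4, y ∈ (boostedKerrBackground Λ c M a).domain → τ₁ + 1 + s < (boostedKerrBackground Λ c M a).time y →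
      Rg ((boostedKerrBackground Λ c M a).time y) + 17 / 20 < (boostedKerrBackground Λ c M a).radius y → (boostedKerrBackground Λ c M a).radius y < Rg ((boostedKerrBackground Λ c M a).time y) + 2 →
      τ₁ ≤ y 0 ∧ τf < y 0 ∧ P y)
    (hGl2 : ∀ x : (boostedKerrBackground Λ c M a).domain, τ₁ + 2 + s ≤ (boostedKerrBackground Λ c M a).time x → (boostedKerrBackground Λ c M a).radius x < b ((boostedKerrBackground Λ c M a).time x) →
      Gl x = Ψ' x)
    (horth : 0 < ((Λ : E4 ≃L[ℝ] E4) (E4.basisVector 0)) 0)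
    (hlag : ∀ y : E4, τ₁ ≤ (boostedKerrBackground Λ c M a).time y → (boostedKerrBackground Λ c M a).radius y ≤ Rg ((boostedKerrBackground Λ c M a).time y) + 2 → (boostedKerrBackground Λ c M a).time y - s ≤ y 0)
    (htube : ∀ y : E4, y ∈ (boostedKerrBackground Λ c M a).domain → τ₁ ≤ y 0 → (boostedKerrBackground Λ c M a).radius y ≤ Rg ((boostedKerrBackground Λ c M a).time y) + 2 → ¬ P y →
      (boostedKerrBackground Λ c M a).radius y + 3 ≤ Rg ((boostedKerrBackground Λ c M a).time y))
    (x : E4) (hx : x ∈ (boostedKerrBackground Λ c M a).domain) (htx : τ₁ + 2 + s ≤ (boostedKerrBackground Λ c M a).time x) (htx2 : (boostedKerrBackground Λ c M a).time x < T + s)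
    (hrx : (boostedKerrBackground Λ c M a).radius x < Rg ((boostedKerrBackground Λ c M a).time x) + 2) :
    Ψ' ⟨x, hx⟩ ∈ 𝓢.metric.causalPast 𝓢.timeOrientation
        (Gl '' {y | (boostedKerrBackground Λ c M a).time y = T + s} ∪ Φ '' {w : W₀ | w.1 0 = T ∧ P w.1}) ∨
      Ψ' ⟨x, hx⟩ ∈ Φ '' {w : W₀ | T < w.1 0 ∧ P w.1} := by
  have htv : ∀ (y : E4) (σ' : ℝ), (boostedKerrBackground Λ c M a).time (y + σ' • (Λ : E4 ≃L[ℝ] E4) (E4.basisVector 0)) =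
      (boostedKerrBackground Λ c M a).time y + σ' := fun y σ' ↦ by
    show poincareInv Λ c (y + σ' • (Λ : E4 ≃L[ℝ] E4) (E4.basisVector 0)) 0 = poincareInv Λ c y 0 + σ'
    rw [poincareInv_add_smul]; simp
  have hrv : ∀ (y : E4) (σ' : ℝ), (boostedKerrBackground Λ c M a).radius (y + σ' • (Λ : E4 ≃L[ℝ] E4) (E4.basisVector 0)) =
      (boostedKerrBackground Λ c M a).radius y := fun y σ' ↦ by
    show Kerr.radius a (poincareInv Λ c (y + σ' • (Λ : E4 ≃L[ℝ] E4) (E4.basisVector 0))) =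
      Kerr.radius a (poincareInv Λ c y)
    rw [poincareInv_add_smul, radius_add_smul_e₀]
  have hb5 : ∀ t, R₁ + 5 ≤ b t := fun t ↦ by linarith [(hbRg t).1, hRg4 t]
  have hflat : ∀ (y : E4) (σ' : ℝ), (y + σ' • (Λ : E4 ≃L[ℝ] E4) (E4.basisVector 0)) 0 =
      y 0 + σ' * ((Λ : E4 ≃L[ℝ] E4) (E4.basisVector 0)) 0 := fun y σ' ↦ by simp
  have hτfx : τf < (boostedKerrBackground Λ c M a).time x := by linarith
  rcases lt_or_ge ((boostedKerrBackground Λ c M a).radius x) (R₁ + 1 / 4) with hsmall | hbig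
  · -- inside `R₁ + 1/4`
    left
    have hΨx : Ψ' ⟨x, hx⟩ = Ψ ⟨x, hx⟩ := hA2 ⟨x, hx⟩ (by show (boostedKerrBackground Λ c M a).radius x ≤ _; linarith)
    have h1 := hHc2 (R₁ + 1 / 2) (T + s) (by linarith) (by linarith)
      ⟨⟨x, hx⟩, ⟨hτfx, htx2, by show (boostedKerrBackground Λ c M a).radius x < _; linarith⟩, rfl⟩
    rw [hΨx]
    refine LorentzianMetric.causalFuture_mono ?_ h1
    rintro _ ⟨y, ⟨hyt, hyr⟩, rfl⟩
    have hyt' : (boostedKerrBackground Λ c M a).time y = T + s := hyt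
    have hyr' : (boostedKerrBackground Λ c M a).radius y ≤ R₁ + 1 / 2 := hyr
    refine Or.inl ⟨y, hyt', ?_⟩
    rw [hGl2 y (by rw [hyt']; linarith) (by linarith [hb5 ((boostedKerrBackground Λ c M a).time y)]), hA2 y (by linarith)]
  · rcases lt_or_ge ((boostedKerrBackground Λ c M a).radius x) (b ((boostedKerrBackground Λ c M a).time x)) with hin | hout
    · -- on the certified tube: ride to hole time `T + s`
      left
      have hu : 0 ≤ T + s - (boostedKerrBackground Λ c M a).time x := by linarith
      have hmem : x + (T + s - (boostedKerrBackground Λ c M a).time x) • (Λ : E4 ≃L[ℝ] E4) (E4.basisVector 0) ∈ (boostedKerrBackground Λ c M a).domain :=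
        hdomeq x _ (hrv x _) hx
      have hride := ride_mem_causalFuture Λ c M a R₁ τ₁ Rg hRgm hRgc Ψ' hA1a hA8 hdomeq x hx
        (by linarith) (by linarith) hrx _ hu hmem
      have hte : (boostedKerrBackground Λ c M a).time (x + (T + s - (boostedKerrBackground Λ c M a).time x) • (Λ : E4 ≃L[ℝ] E4) (E4.basisVector 0)) =
          T + s := by rw [htv]; ring
      have hre := hrv x (T + s - (boostedKerrBackground Λ c M a).time x)
      have hGle : Gl ⟨_, hmem⟩ = Ψ' ⟨_, hmem⟩ := hGl2 _ (by show _ ≤ (boostedKerrBackground Λ c M a).time _; rw [hte]; linarith)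
        (by show (boostedKerrBackground Λ c M a).radius _ < b ((boostedKerrBackground Λ c M a).time _); rw [hre, hte]; exact hin.trans_le (hbm (by linarith)))
      refine LorentzianMetric.causalFuture_mono ?_
        (LorentzianMetric.mem_causalPast_of_mem_causalFuture hride)
      rintro _ rfl
      exact Or.inl ⟨⟨_, hmem⟩, hte, hGle⟩
    · -- on and beyond the shell: `Ψ' x` is a flat point outside the tubes
      obtain ⟨hx0, hxf, hPx⟩ := hcollar x hx (by linarith) (by linarith [(hbRg ((boostedKerrBackground Λ c M a).time x)).1]) hrx
      obtain ⟨hwx, hΨx⟩ := hA3 x hx hx0 hPx hrx.le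
      rcases lt_trichotomy T (x 0) with hgt | heq | hlt
      · right
        exact ⟨⟨x, hwx⟩, ⟨hgt, hPx⟩, hΨx.symm⟩
      · left
        rw [hΨx]
        exact LorentzianMetric.subset_causalPast _ _ _ (Or.inr ⟨⟨x, hwx⟩, ⟨heq.symm, hPx⟩, rfl⟩)
      · left
        -- ride from `x` until flat time `T`
        set γ : ℝ := ((Λ : E4 ≃L[ℝ] E4) (E4.basisVector 0)) 0 with hγ
        set u₁ : ℝ := T + s - (boostedKerrBackground Λ c M a).time x with hu₁
        set us : ℝ := (T - x 0) / γ with hus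
        have hus0 : 0 ≤ us := div_nonneg (by linarith) horth.le
        have hu₁0 : 0 < u₁ := by rw [hu₁]; linarith
        have hmem : ∀ u : ℝ, x + u • (Λ : E4 ≃L[ℝ] E4) (E4.basisVector 0) ∈ (boostedKerrBackground Λ c M a).domain := fun u ↦
          hdomeq x _ (hrv x _) hx
        have hrideu : ∀ u : ℝ, 0 ≤ u →
            Ψ' ⟨x + u • (Λ : E4 ≃L[ℝ] E4) (E4.basisVector 0), hmem u⟩ ∈
              𝓢.metric.causalFuture 𝓢.timeOrientation {Ψ' ⟨x, hx⟩} := fun u hu ↦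
          ride_mem_causalFuture Λ c M a R₁ τ₁ Rg hRgm hRgc Ψ' hA1a hA8 hdomeq x hx (by linarith)
            (by linarith [hb5 ((boostedKerrBackground Λ c M a).time x)]) hrx u hu (hmem u)
        -- the flat time `T` is reached before hole time `T + s`
        have hte₁ : (boostedKerrBackground Λ c M a).time (x + u₁ • (Λ : E4 ≃L[ℝ] E4) (E4.basisVector 0)) = T + s := by
          rw [htv, hu₁]; ring
        have hre₁ := hrv x u₁
        have hlag₁ := hlag (x + u₁ • (Λ : E4 ≃L[ℝ] E4) (E4.basisVector 0)) (by rw [hte₁]; linarith)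
          (by rw [hre₁, hte₁]; linarith [hRgm (show (boostedKerrBackground Λ c M a).time x ≤ T + s by linarith)])
        rw [hte₁, hflat] at hlag₁
        have husu₁ : us ≤ u₁ := by
          rw [hus, div_le_iff₀ horth]
          linarith
        have hflat_e : (x + us • (Λ : E4 ≃L[ℝ] E4) (E4.basisVector 0)) 0 = T := by
          rw [hflat, hus, div_mul_cancel₀ _ horth.ne']
          ring
        have hte : (boostedKerrBackground Λ c M a).time (x + us • (Λ : E4 ≃L[ℝ] E4) (E4.basisVector 0)) = (boostedKerrBackground Λ c M a).time x + us :=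
          htv x us
        have hre := hrv x us
        have hte' : (boostedKerrBackground Λ c M a).time x ≤ (boostedKerrBackground Λ c M a).time (x + us • (Λ : E4 ≃L[ℝ] E4) (E4.basisVector 0)) := by
          rw [hte]; linarith
        have hrRg : (boostedKerrBackground Λ c M a).radius (x + us • (Λ : E4 ≃L[ℝ] E4) (E4.basisVector 0)) ≤
            Rg ((boostedKerrBackground Λ c M a).time (x + us • (Λ : E4 ≃L[ℝ] E4) (E4.basisVector 0))) + 2 := by
          rw [hre]; linarith [hRgm hte']
        by_cases hPe : P (x + us • (Λ : E4 ≃L[ℝ] E4) (E4.basisVector 0))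
        · obtain ⟨hwe, hΨe⟩ := hA3 _ (hmem us) (by rw [hflat_e]; linarith) hPe hrRg
          refine LorentzianMetric.causalFuture_mono ?_
            (LorentzianMetric.mem_causalPast_of_mem_causalFuture (hrideu us hus0))
          rintro _ rfl
          exact Or.inr ⟨⟨_, hwe⟩, ⟨hflat_e, hPe⟩, hΨe.symm⟩
        · have hdeep := htube _ (hmem us) (by rw [hflat_e]; linarith) hrRg hPe
          rw [hre, hte] at hdeep
          have hGle : Gl ⟨_, hmem u₁⟩ = Ψ' ⟨_, hmem u₁⟩ := hGl2 _
            (by show _ ≤ (boostedKerrBackground Λ c M a).time _; rw [hte₁]; linarith)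
            (by show (boostedKerrBackground Λ c M a).radius _ < b ((boostedKerrBackground Λ c M a).time _); rw [hre₁, hte₁]
                linarith [hb5 (T + s), (hbRg (T + s)).1,
                  hRgm (show (boostedKerrBackground Λ c M a).time x + us ≤ T + s by rw [hu₁] at husu₁; linarith)])
          refine LorentzianMetric.causalFuture_mono ?_
            (LorentzianMetric.mem_causalPast_of_mem_causalFuture (hrideu u₁ hu₁0.le))
          rintro _ rfl
          exact Or.inl ⟨⟨_, hmem u₁⟩, hte₁, hGle⟩

/-- **Every collar/tube point of the re-gauged chart is causally below the late charted region
of the seamed decomposition** (used for `O = exteriorOf 𝒟 d₂.charted`).  For `x` with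
`t ≥ τ₁ + 2 + s` and `r < Rg + 2`, `Ψ' x ∈ J⁻(Gl{t > T + s} ∪ Φ{y⁰ > T, outside the tubes})`:
input anchoring inside `R₁ + 1/4`, otherwise the ride to hole time `max t (T + s) + 1`, which ends
in the late `Ψ'`-part of `Gl` or at a flat-late collar point.  O'Neill 1983, Ch. 14, p. 402.
[folklore] -/
theorem upward {𝓢 : Spacetime.{0} 4} (Λ : lorentzGroup) (c : E4) (M a R₁ τ₁ s τf T : ℝ)
    (hs : 0 ≤ s) (hτ : τf ≤ τ₁) (hT : τ₁ + 3 ≤ T)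
    (hdomeq : ∀ y y' : E4, (boostedKerrBackground Λ c M a).radius y' = (boostedKerrBackground Λ c M a).radius y → y ∈ (boostedKerrBackground Λ c M a).domain → y' ∈ (boostedKerrBackground Λ c M a).domain)
    (Rg : ℝ → ℝ) (hRgm : Monotone Rg) (hRgc : Continuous Rg) (hRg4 : ∀ t, R₁ + 4 ≤ Rg t)
    (b : ℝ → ℝ) (hbRg : ∀ t, Rg t + 21 / 20 ≤ b t ∧ b t ≤ Rg t + 29 / 20)
    (Ψ Ψ' Gl : (boostedKerrBackground Λ c M a).domain → 𝓢.carrier)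
    (hA1a : ContMDiffOn 𝓘(ℝ, E4) (𝓡 4) ∞ Ψ'
      {x | τ₁ < (boostedKerrBackground Λ c M a).time x ∧ (boostedKerrBackground Λ c M a).radius x < Rg ((boostedKerrBackground Λ c M a).time x) + 2})
    (hA2 : ∀ x : (boostedKerrBackground Λ c M a).domain, (boostedKerrBackground Λ c M a).radius x ≤ R₁ + 1 → Ψ' x = Ψ x)
    (hA8 : ∀ x : (boostedKerrBackground Λ c M a).domain, τ₁ ≤ (boostedKerrBackground Λ c M a).time x → R₁ ≤ (boostedKerrBackground Λ c M a).radius x →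
      (boostedKerrBackground Λ c M a).radius x ≤ Rg ((boostedKerrBackground Λ c M a).time x) + 2 →
      𝓢.timeOrientation.IsFutureDirected (mfderiv 𝓘(ℝ, E4) (𝓡 4) Ψ' x ((Λ : E4 ≃L[ℝ] E4) (E4.basisVector 0))))
    (hHc2 : ∀ ϱ τ₂ : ℝ, R₁ ≤ ϱ → τf < τ₂ →
      Ψ '' {x | τf < (boostedKerrBackground Λ c M a).time x ∧ (boostedKerrBackground Λ c M a).time x < τ₂ ∧ (boostedKerrBackground Λ c M a).radius x < ϱ} ⊆
        𝓢.metric.causalPast 𝓢.timeOrientation (Ψ '' (boostedKerrBackground Λ c M a).truncTimeSlab ϱ τ₂))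
    (W₀ : TopologicalSpace.Opens E4) (Φ : W₀ → 𝓢.carrier) (P : E4 → Prop)
    (hA3 : ∀ (y : E4) (hy : y ∈ (boostedKerrBackground Λ c M a).domain), τ₁ ≤ y 0 → P y →
      (boostedKerrBackground Λ c M a).radius y ≤ Rg ((boostedKerrBackground Λ c M a).time y) + 2 → ∃ hw : y ∈ W₀, Ψ' ⟨y, hy⟩ = Φ ⟨y, hw⟩)
    (hcollar : ∀ y : E4, y ∈ (boostedKerrBackground Λ c M a).domain → τ₁ + 1 + s < (boostedKerrBackground Λ c M a).time y →
      Rg ((boostedKerrBackground Λ c M a).time y) + 17 / 20 < (boostedKerrBackground Λ c M a).radius y → (boostedKerrBackground Λ c M a).radius y < Rg ((boostedKerrBackground Λ c M a).time y) + 2 →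
      τ₁ ≤ y 0 ∧ τf < y 0 ∧ P y)
    (hGl2 : ∀ x : (boostedKerrBackground Λ c M a).domain, τ₁ + 2 + s ≤ (boostedKerrBackground Λ c M a).time x → (boostedKerrBackground Λ c M a).radius x < b ((boostedKerrBackground Λ c M a).time x) →
      Gl x = Ψ' x)
    (hlag : ∀ y : E4, τ₁ ≤ (boostedKerrBackground Λ c M a).time y → (boostedKerrBackground Λ c M a).radius y ≤ Rg ((boostedKerrBackground Λ c M a).time y) + 2 → (boostedKerrBackground Λ c M a).time y - s ≤ y 0)
    (x : E4) (hx : x ∈ (boostedKerrBackground Λ c M a).domain) (htx : τ₁ + 2 + s ≤ (boostedKerrBackground Λ c M a).time x)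
    (hrx : (boostedKerrBackground Λ c M a).radius x < Rg ((boostedKerrBackground Λ c M a).time x) + 2) :
    Ψ' ⟨x, hx⟩ ∈ 𝓢.metric.causalPast 𝓢.timeOrientation
      (Gl '' {y | T + s < (boostedKerrBackground Λ c M a).time y} ∪ Φ '' {w : W₀ | T < w.1 0 ∧ P w.1}) := by
  have htv : ∀ (y : E4) (σ' : ℝ), (boostedKerrBackground Λ c M a).time (y + σ' • (Λ : E4 ≃L[ℝ] E4) (E4.basisVector 0)) =
      (boostedKerrBackground Λ c M a).time y + σ' := fun y σ' ↦ by
    show poincareInv Λ c (y + σ' • (Λ : E4 ≃L[ℝ] E4) (E4.basisVector 0)) 0 = poincareInv Λ c y 0 + σ'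
    rw [poincareInv_add_smul]; simp
  have hrv : ∀ (y : E4) (σ' : ℝ), (boostedKerrBackground Λ c M a).radius (y + σ' • (Λ : E4 ≃L[ℝ] E4) (E4.basisVector 0)) =
      (boostedKerrBackground Λ c M a).radius y := fun y σ' ↦ by
    show Kerr.radius a (poincareInv Λ c (y + σ' • (Λ : E4 ≃L[ℝ] E4) (E4.basisVector 0))) =
      Kerr.radius a (poincareInv Λ c y)
    rw [poincareInv_add_smul, radius_add_smul_e₀]
  have hb5 : ∀ t, R₁ + 5 ≤ b t := fun t ↦ by linarith [(hbRg t).1, hRg4 t]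
  have hτfx : τf < (boostedKerrBackground Λ c M a).time x := by linarith
  set tstar : ℝ := max ((boostedKerrBackground Λ c M a).time x) (T + s) + 1 with htstar
  have ht1 : (boostedKerrBackground Λ c M a).time x + 1 ≤ tstar := by rw [htstar]; linarith [le_max_left ((boostedKerrBackground Λ c M a).time x) (T + s)]
  have ht2 : T + s + 1 ≤ tstar := by rw [htstar]; linarith [le_max_right ((boostedKerrBackground Λ c M a).time x) (T + s)]
  rcases lt_or_ge ((boostedKerrBackground Λ c M a).radius x) (R₁ + 1 / 4) with hsmall | hbig
  · have hΨx : Ψ' ⟨x, hx⟩ = Ψ ⟨x, hx⟩ := hA2 ⟨x, hx⟩ (by show (boostedKerrBackground Λ c M a).radius x ≤ _; linarith)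
    have h1 := hHc2 (R₁ + 1 / 2) tstar (by linarith) (by linarith)
      ⟨⟨x, hx⟩, ⟨hτfx, by show (boostedKerrBackground Λ c M a).time x < tstar; linarith, by show (boostedKerrBackground Λ c M a).radius x < _; linarith⟩,
        rfl⟩
    rw [hΨx]
    refine LorentzianMetric.causalFuture_mono ?_ h1
    rintro _ ⟨y, ⟨hyt, hyr⟩, rfl⟩
    have hyt' : (boostedKerrBackground Λ c M a).time y = tstar := hyt
    have hyr' : (boostedKerrBackground Λ c M a).radius y ≤ R₁ + 1 / 2 := hyr
    refine Or.inl ⟨y, by show T + s < (boostedKerrBackground Λ c M a).time y; rw [hyt']; linarith, ?_⟩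
    rw [hGl2 y (by rw [hyt']; linarith) (by linarith [hb5 ((boostedKerrBackground Λ c M a).time y)]), hA2 y (by linarith)]
  · have hu : 0 ≤ tstar - (boostedKerrBackground Λ c M a).time x := by linarith
    have hmem : x + (tstar - (boostedKerrBackground Λ c M a).time x) • (Λ : E4 ≃L[ℝ] E4) (E4.basisVector 0) ∈ (boostedKerrBackground Λ c M a).domain :=
      hdomeq x _ (hrv x _) hx
    have hride := ride_mem_causalFuture Λ c M a R₁ τ₁ Rg hRgm hRgc Ψ' hA1a hA8 hdomeq x hx
      (by linarith) (by linarith [hb5 ((boostedKerrBackground Λ c M a).time x)]) hrx _ hu hmem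
    have hte : (boostedKerrBackground Λ c M a).time (x + (tstar - (boostedKerrBackground Λ c M a).time x) • (Λ : E4 ≃L[ℝ] E4) (E4.basisVector 0)) =
        tstar := by rw [htv]; ring
    have hre := hrv x (tstar - (boostedKerrBackground Λ c M a).time x)
    refine LorentzianMetric.causalFuture_mono ?_
      (LorentzianMetric.mem_causalPast_of_mem_causalFuture hride)
    rintro _ rfl
    rcases lt_or_ge ((boostedKerrBackground Λ c M a).radius x) (b tstar) with hin | hout
    · refine Or.inl ⟨⟨_, hmem⟩, by show T + s < (boostedKerrBackground Λ c M a).time _; rw [hte]; linarith, ?_⟩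
      exact hGl2 _ (by show _ ≤ (boostedKerrBackground Λ c M a).time _; rw [hte]; linarith)
        (by show (boostedKerrBackground Λ c M a).radius _ < b ((boostedKerrBackground Λ c M a).time _); rw [hre, hte]; exact hin)
    · have hrRg : (boostedKerrBackground Λ c M a).radius (x + (tstar - (boostedKerrBackground Λ c M a).time x) • (Λ : E4 ≃L[ℝ] E4) (E4.basisVector 0)) <
          Rg ((boostedKerrBackground Λ c M a).time (x + (tstar - (boostedKerrBackground Λ c M a).time x) • (Λ : E4 ≃L[ℝ] E4) (E4.basisVector 0))) + 2 := by
        rw [hre, hte]; linarith [hRgm (show (boostedKerrBackground Λ c M a).time x ≤ tstar by linarith)]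
      obtain ⟨he0, -, hPe⟩ := hcollar _ hmem (by rw [hte]; linarith)
        (by rw [hre, hte]; linarith [(hbRg tstar).1]) hrRg
      obtain ⟨hwe, hΨe⟩ := hA3 _ hmem he0 hPe hrRg.le
      have hlage := hlag _ (by rw [hte]; linarith) hrRg.le
      rw [hte] at hlage
      exact Or.inr ⟨⟨_, hwe⟩, ⟨by show T < _; linarith, hPe⟩, hΨe.symm⟩


end Summit.FinalStateConjecture.FinalStateConjecture.Theorems.NecksCertifyTwoCap.Seam

end
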